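import Literature.MathematicalPhysics.QuantumFieldTheory.Balaban1983to89.B5Action121
import Literature.MathematicalPhysics.QuantumFieldTheory.Balaban1983to89.B5Block118

/-!
# T⁴ programme, spine node NE2 (U1a), sub-row Δ1 — THE GRADED WELL, file 1: SUB-BLOCK AVERAGING AT AN ARBITRARY SCALE `s`
# on ONE torus `Tor N`, indexed by ANCHORS (no re-indexing of the torus type), with the exact identities a graded
# absorber needs: `Q′_s·Q′_sᴴ = s^{−d}·1` and Bałaban's `Q_s ∂ = ∂_s Q′_s` ((1.55)) at scale `s`

Row NE2 OWNER (unit `b2b-balaban-t4-ne2-p1`, gen 16), item O16-a, first brick of RULING R47 (journal 2026-08-21 l.25022):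
the Δ1 region front is RE-BASED on the «GRADED WELL» — the U = 1 typing of [Balaban1984PropagatorsII] (2.1)–(2.3)/(2.7)/(2.20)
«Ω₀ ⊃ Ω₁ ⊃ … ⊃ Ω_k, Ω_j a union of L^jη-blocks, Λ_j = Ω_j ∖ Ω_{j+1} … for the sets of sites and the sets of bonds», «λ = 0 on
Λ₀, Q′_jλ = 0 on Λ_j», and [Balaban1985BackgroundPropagators] (3.16) «⟨A, Q*aQ A⟩ = Σ_{j=0}^{k} a Σ_{b∈Λ_j} (L^jη)^{d−2}|(Q_j(U)A)(b)|²»: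
around the carrier `Ω_k` (unit-lattice averaging) sit LAYERS carrying block averagings of the INTERMEDIATE scales `L^jη`,
`j = k−1, k−2, …` — sub-blocks of side `s = L^j` fine sites — with masses growing outward.  Every layer therefore needs
Bałaban's scalar block mean `Q′` and straight-contour vector average `Q` ([Balaban1984PropagatorsI] (1.18)) AT SCALE `s` on the
level-`k` torus `Tor (fine (L^k) M)`.  The tree has them only at the unit scale `s = n` (`B5Block118.QsOp`/`QvOp`, rows indexed by
`Tor M`); re-indexing the torus type per scale (`ZMod (L^{k−j}·(L^j·M_ν))` vs `ZMod (L^k·M_ν)`) is not definitional.  THIS FILE types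
both averagings at an ARBITRARY scale `s ∣ N_ν` on the FIXED torus `Tor N`, with rows indexed by the ANCHORS of the sub-blocks
(sites with all coordinates divisible by `s`) — a subtype of `Tor N`, so every scale of the graded well lives on one index type.

 * §1 sub-block geometry by coordinate VALUES: `Anchor N s z :≡ ∀ν, s ∣ (z ν).val`, `InSub N s z y :≡ ∀ν, ⌊y_ν/s⌋ = ⌊z_ν/s⌋`,
   the offset parametrisation `site z j = z + j` (`j : Fin d → Fin s`) of the sub-block of an anchor (no wrap-around:
   `val_site`), `inSub_site`, `eq_site_of_inSub`, `site_injective`, hence **`sum_inSub`**: `Σ_y [y ∈ B_s(z)]·g y = Σ_j g (z + j)`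
   (the sub-block has exactly `s^d` sites); anchors are unique representatives (`anchor_eq_of_inSub`); `z + s·e_μ` is again an
   anchor (`anchor_add_tstep`).
 * §2 the SCALAR sub-block mean `meanS N s : Matrix (Anc N s) (Tor N) ℂ`, entries `s^{−d}·[y ∈ B_s(z)]` (= `QsOp` at `s = n`
   up to the row bijection `Tor M ≃ Anc`): `meanS_mulVec`, **`meanS_mul_conjTranspose : Q′_s·Q′_sᴴ = s^{−d}·1`**.
 * §3 the VECTOR straight-contour average `avgS N s : Matrix (Anc N s × Fin d) (Tor N × Fin d) ℂ`,
   `(Q_sA)(z,μ) = s^{−(d+1)}·Σ_{x∈B_s(z)} Σ_{t<s} A(x + t e_μ, μ)` (**`avgS_mulVec`** — (1.18) at scale `s`), and BAŁABAN's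
   INTERTWINER AT SCALE `s`: **`avgS_GradOp_mulVec`** `(Q_s ∂λ)(z,μ) = (c/s)·((Q′_sλ)(z + s e_μ) − (Q′_sλ)(z))` and its matrix form
   **`avgS_mul_GradOp : avgS·GradOp N c = gradS N s c·meanS`** (`gradS` = the scale-`s` forward gradient on anchors, factor `c/s`)
   — the `avg_grad` field of `RegionGaugeSlice.SliceData` for ONE layer of the graded well.
File 2 (`Support/GradedWellData`) assembles the layers (scale `s_i = L^{k−i}` on layer `i`, print's `st`-convention for the
interface bonds, masses `a·L^{2i}·s_i^d`) into `QsGW`/`QvGW`/`DpGW`/`regionGW := gaugeFixed …` on the torus.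

HONEST FRAMING (T4-DAG p. 1).  [folklore] finite-torus combinatorics at `U = 1`; the `[cite:]` tags locate printed SHAPES; no estimate,
no two-level law, no conditional of the cell; NOT [B9] (3.16)/(3.23)–(3.27) as printed (one torus, abelian/`U = 1`, regions not yet
present in this file); NE2 (U1a) NOT proved; spine PROVED 0/9 unchanged; NOT infinite volume / mass gap / Clay.  HONEST DEPENDENCY:
continuum YM on T⁴ ⇐ BetaPertH ∧ nine spine estimates (0/9 proved); BetaPertH ⇐ (D1) ∧ (D4) ∧ CAP+tail; G-an2-4 gates asym, D1
and NE2/3/4.  No `sorry`.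
-/

noncomputable section

open scoped BigOperators ComplexConjugate Matrix
open Finset

namespace Summit.QuantumFields.BalabanUV.T4Continuum.GradedSubBlocks

open Literature.MathematicalPhysics.QuantumFieldTheory.Balaban1983to89.B5Prop11Plancherel (Tor unitVec)
open Literature.MathematicalPhysics.QuantumFieldTheory.Balaban1983to89.B5Block118 (tstep tstep_zero tstep_succ)
open Literature.MathematicalPhysics.QuantumFieldTheory.Balaban1983to89.B5Action121 (GradOp GradOp_mulVec sdiff_mulVec)

variable {d : ℕ} (N : Fin d → ℕ) [hN : ∀ ν, NeZero (N ν)] (s : ℕ) [NeZero s]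

/-! ## §1 Sub-blocks of side `s` by coordinate values: anchors, membership, the offset parametrisation -/

/-- ANCHORS of the scale-`s` sub-blocks: sites all of whose coordinate values are divisible by `s`
(the sub-block of `z` is `{y : ⌊y_ν/s⌋ = z_ν/s ∀ν}`). [cite: Balaban1984PropagatorsII, (2.1) p.224 (shape: «union of L^jη-blocks»)] [folklore] -/
def Anchor : Tor N → Prop := fun z => ∀ ν, s ∣ (z ν).val

/-- decidability of the anchor predicate. [folklore] -/
instance decAnchor : DecidablePred (Anchor N s) := fun z => inferInstanceAs (Decidable (∀ ν, s ∣ (z ν).val))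

/-- the anchor type (row index of every scale-`s` averaging). [folklore] -/
abbrev Anc : Type := {z : Tor N // Anchor N s z}

/-- MEMBERSHIP of the site `y` in the scale-`s` sub-block of `z`: `⌊y_ν/s⌋ = ⌊z_ν/s⌋` for every `ν`.
[cite: King1986, (2.10) p.653 (shape: «B^k(y)»)] [folklore] -/
def InSub : Tor N → Tor N → Prop := fun z y => ∀ ν, (y ν).val / s = (z ν).val / s

/-- decidability of membership. [folklore] -/
instance decInSub (z y : Tor N) : Decidable (InSub N s z y) :=
  inferInstanceAs (Decidable (∀ ν, (y ν).val / s = (z ν).val / s))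

/-- the site of OFFSET `j ∈ [0,s)^d` in the sub-block of `z`: `z + j`. [folklore] -/
def site (z : Tor N) (j : Fin d → Fin s) : Tor N := fun ν => z ν + ((j ν : ℕ) : ZMod (N ν))

omit hN [NeZero s] in
/-- membership is reflexive. [folklore] -/
theorem inSub_refl (z : Tor N) : InSub N s z z := fun _ => rfl

/-- `0 < s`. [folklore] -/
theorem s_pos : 0 < s := Nat.pos_of_ne_zero (NeZero.ne s)

omit [NeZero s] in
/-- no wrap-around inside a sub-block: for an anchor `z` and `s ∣ N_ν`, `z_ν + j_ν < N_ν`. [folklore] -/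
theorem val_add_lt (hs : ∀ ν, s ∣ N ν) {z : Tor N} (hz : Anchor N s z) (j : Fin d → Fin s) (ν : Fin d) :
    (z ν).val + (j ν : ℕ) < N ν := by
  obtain ⟨q, hq⟩ := hz ν
  obtain ⟨m, hm⟩ := hs ν
  have hzlt : (z ν).val < N ν := ZMod.val_lt _
  have hj : (j ν : ℕ) < s := (j ν).isLt
  have hqm : q < m := by
    by_contra h
    push Not at h
    have h1 : s * m ≤ s * q := Nat.mul_le_mul_left _ h
    omega
  calc (z ν).val + (j ν : ℕ) < s * q + s := by omega
    _ = s * (q + 1) := by ring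
    _ ≤ s * m := Nat.mul_le_mul_left _ hqm
    _ = N ν := hm.symm

omit [NeZero s] in
/-- the coordinate values of `z + j`: `(z + j)_ν = z_ν + j_ν`. [folklore] -/
theorem val_site (hs : ∀ ν, s ∣ N ν) {z : Tor N} (hz : Anchor N s z) (j : Fin d → Fin s) (ν : Fin d) :
    (site N s z j ν).val = (z ν).val + (j ν : ℕ) := by
  have hlt := val_add_lt N s hs hz j ν
  have hjN : (j ν : ℕ) < N ν := lt_of_le_of_lt (Nat.le_add_left _ _) hlt
  unfold site
  rw [ZMod.val_add_of_lt, ZMod.val_cast_of_lt hjN]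
  rwa [ZMod.val_cast_of_lt hjN]

/-- `z + j` lies in the sub-block of the anchor `z`. [folklore] -/
theorem inSub_site (hs : ∀ ν, s ∣ N ν) {z : Tor N} (hz : Anchor N s z) (j : Fin d → Fin s) :
    InSub N s z (site N s z j) := by
  intro ν
  rw [val_site N s hs hz j ν]
  obtain ⟨q, hq⟩ := hz ν
  rw [hq, Nat.mul_add_div (s_pos s), Nat.div_eq_of_lt (j ν).isLt, add_zero, Nat.mul_div_cancel_left _ (s_pos s)]

/-- every site of the sub-block of an anchor `z` is `z + j` for a (unique) offset `j`. [folklore] -/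
theorem eq_site_of_inSub {z : Tor N} (hz : Anchor N s z) {y : Tor N} (hy : InSub N s z y) :
    ∃ j : Fin d → Fin s, y = site N s z j := by
  have hb : ∀ ν, (z ν).val ≤ (y ν).val ∧ (y ν).val < (z ν).val + s := by
    intro ν
    obtain ⟨q, hq⟩ := hz ν
    have h1 : (y ν).val / s = q := by rw [hy ν, hq, Nat.mul_div_cancel_left _ (s_pos s)]
    have h2 := Nat.div_mul_le_self (y ν).val s
    have h3 := Nat.lt_div_mul_add (a := (y ν).val) (s_pos s)
    rw [h1] at h2 h3
    constructor
    · rw [hq, mul_comm]; exact h2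
    · rw [hq, mul_comm]; linarith
  refine ⟨fun ν => ⟨(y ν).val - (z ν).val, by have := hb ν; omega⟩, ?_⟩
  funext ν
  have h1 : (z ν).val ≤ (y ν).val := (hb ν).1
  unfold site
  rw [Nat.cast_sub h1, ZMod.natCast_zmod_val, ZMod.natCast_zmod_val, add_sub_cancel]

omit [NeZero s] in
/-- the offset parametrisation is injective. [folklore] -/
theorem site_injective (hs : ∀ ν, s ∣ N ν) {z : Tor N} (hz : Anchor N s z) :
    Function.Injective (site N s z) := by
  intro j j' h
  funext ν
  apply Fin.ext
  have h1 := congrArg (fun y : Tor N => (y ν).val) h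
  simp only [val_site N s hs hz] at h1
  omega

/-- **THE SUB-BLOCK SUM**: `Σ_y [y ∈ B_s(z)]·g(y) = Σ_{j∈[0,s)^d} g(z + j)` — the sub-block of an anchor has exactly `s^d` sites,
parametrised by offsets. [cite: King1986, (2.10) p.653 (shape)] [folklore] -/
theorem sum_inSub (hs : ∀ ν, s ∣ N ν) {z : Tor N} (hz : Anchor N s z) (g : Tor N → ℂ) :
    ∑ y, (if InSub N s z y then g y else 0) = ∑ j : Fin d → Fin s, g (site N s z j) := by
  rw [← Finset.sum_filter]
  have hset : (univ.filter fun y => InSub N s z y) = (univ : Finset (Fin d → Fin s)).image (site N s z) := by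
    ext y
    simp only [mem_filter, mem_univ, true_and, mem_image]
    constructor
    · intro hy
      obtain ⟨j, hj⟩ := eq_site_of_inSub N s hz hy
      exact ⟨j, hj.symm⟩
    · rintro ⟨j, rfl⟩
      exact inSub_site N s hs hz j
  rw [hset, Finset.sum_image fun j _ j' _ h => site_injective N s hs hz h]

/-- anchors are UNIQUE representatives: two anchors with the same sub-block coincide. [folklore] -/
theorem anchor_eq_of_inSub {z w : Tor N} (hz : Anchor N s z) (hw : Anchor N s w) (h : InSub N s z w) : z = w := by
  funext ν
  apply ZMod.val_injective
  obtain ⟨q, hq⟩ := hz ν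
  obtain ⟨r, hr⟩ := hw ν
  have h1 := h ν
  rw [hq, hr, Nat.mul_div_cancel_left _ (s_pos s), Nat.mul_div_cancel_left _ (s_pos s)] at h1
  rw [hq, hr, h1]

omit [NeZero s] in
/-- the NEXT anchor in direction `μ`: `z + s·e_μ` is again an anchor (`s ∣ N_μ`). [folklore] -/
theorem anchor_add_tstep (hs : ∀ ν, s ∣ N ν) {z : Tor N} (hz : Anchor N s z) (μ : Fin d) :
    Anchor N s (z + tstep N μ s) := by
  intro ν
  simp only [Pi.add_apply, tstep]
  by_cases h : ν = μ
  · subst h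
    simp only [if_true]
    rw [ZMod.val_add, Nat.dvd_mod_iff (hs ν), ZMod.val_natCast]
    exact (Nat.dvd_add_right (hz ν)).mpr ((Nat.dvd_mod_iff (hs ν)).mpr dvd_rfl)
  · simp only [if_neg h, add_zero]
    exact hz ν

/-- the next anchor in direction `μ`, as an element of the anchor type. [folklore] -/
def shiftAnc (hs : ∀ ν, s ∣ N ν) (μ : Fin d) (z : Anc N s) : Anc N s :=
  ⟨z.1 + tstep N μ s, anchor_add_tstep N s hs z.2 μ⟩

omit hN [NeZero s] in
/-- offsets commute with translations: `(z + v) + j = (z + j) + v`. [folklore] -/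
theorem site_add (z v : Tor N) (j : Fin d → Fin s) : site N s (z + v) j = site N s z j + v := by
  funext ν
  simp only [site, Pi.add_apply]
  ring

/-! ## §2 The scalar sub-block mean `Q′_s` -/

/-- **THE SCALAR SUB-BLOCK MEAN AT SCALE `s`**: `(Q′_sλ)(z) = s^{−d}·Σ_{y∈B_s(z)} λ(y)`, rows indexed by anchors
(`B5Block118.QsOp` at `s = n` up to `Tor M ≃ Anc`). [cite: Balaban1984PropagatorsI, (1.14) p.19 (shape); Balaban1984PropagatorsII, (2.7) p.225 (shape: Q′_j)] [folklore] -/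
def meanS : Matrix (Anc N s) (Tor N) ℂ := fun z y => if InSub N s z.1 y then (((s : ℂ) ^ d)⁻¹) else 0

/-- `(Q′_sλ)(z) = s^{−d}·Σ_j λ(z + j)`. [folklore] -/
theorem meanS_mulVec (hs : ∀ ν, s ∣ N ν) (z : Anc N s) (f : Tor N → ℂ) :
    (meanS N s *ᵥ f) z = ((s : ℂ) ^ d)⁻¹ * ∑ j : Fin d → Fin s, f (site N s z.1 j) := by
  simp only [Matrix.mulVec, dotProduct, meanS, ite_mul, zero_mul]
  rw [Finset.mul_sum, ← sum_inSub N s hs z.2 (fun y => ((s : ℂ) ^ d)⁻¹ * f y)]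

omit hN [NeZero s] in
/-- the number of offsets is `s^d` (as a complex number: `Σ_j 1 = s^d`). [folklore] -/
theorem sum_offsets_one : ∑ _j : Fin d → Fin s, (1 : ℂ) = (s : ℂ) ^ d := by
  rw [Finset.sum_const, Finset.card_univ, Fintype.card_fun, Fintype.card_fin, Fintype.card_fin, nsmul_eq_mul, mul_one]
  push_cast
  ring

/-- **`Q′_s·Q′_sᴴ = s^{−d}·1`** (the sub-blocks of distinct anchors are disjoint and have `s^d` sites each).
[cite: Balaban1984PropagatorsI, (1.14) p.19 (shape)] [folklore] -/
theorem meanS_mul_conjTranspose (hs : ∀ ν, s ∣ N ν) :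
    meanS N s * (meanS N s)ᴴ = (((s : ℂ) ^ d)⁻¹) • (1 : Matrix (Anc N s) (Anc N s) ℂ) := by
  have hsc : ((s : ℂ) ^ d) ≠ 0 := pow_ne_zero _ (by exact_mod_cast (NeZero.ne s))
  ext z w
  simp only [Matrix.mul_apply, Matrix.conjTranspose_apply, meanS, Matrix.smul_apply, Matrix.one_apply, smul_eq_mul]
  by_cases hzw : z = w
  · subst hzw
    simp only [if_true, mul_one]
    have h1 : ∀ y, (if InSub N s z.1 y then ((s : ℂ) ^ d)⁻¹ else 0) * star (if InSub N s z.1 y then ((s : ℂ) ^ d)⁻¹ else 0)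
        = if InSub N s z.1 y then (((s : ℂ) ^ d)⁻¹ * ((s : ℂ) ^ d)⁻¹) else 0 := by
      intro y
      split_ifs
      · rw [star_inv₀, star_pow, Complex.star_def, Complex.conj_natCast]
      · simp
    simp_rw [h1]
    rw [sum_inSub N s hs z.2, Finset.sum_const, Finset.card_univ, Fintype.card_fun, Fintype.card_fin, Fintype.card_fin,
      nsmul_eq_mul]
    push_cast
    field_simp
  · rw [if_neg hzw, mul_zero]
    refine Finset.sum_eq_zero fun y _ => ?_
    by_cases hy : InSub N s z.1 y
    · have hy' : ¬ InSub N s w.1 y := by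
        intro hw
        apply hzw
        exact Subtype.ext (anchor_eq_of_inSub N s z.2 w.2 fun ν => (hw ν).symm.trans (hy ν))
      rw [if_neg hy', star_zero, mul_zero]
    · rw [if_neg hy, zero_mul]

/-! ## §3 The vector straight-contour average `Q_s` and Bałaban's intertwiner at scale `s` -/

/-- **THE VECTOR STRAIGHT-CONTOUR AVERAGE AT SCALE `s`**: `(Q_sA)(z,μ) = s^{−(d+1)}·Σ_{x∈B_s(z)} Σ_{t<s} A(x + t e_μ, μ)` — the
average over the sub-block of the straight contours of `s` bonds in direction `μ` (they leave the sub-block), written bond by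
bond: the weight of the fine bond `(y, μ)` is `s^{−1}·Σ_{t<s} Q′_s(z, y − t e_μ)`.  (`B5Block118.QvOp` at `s = n` up to the row
bijection.) [cite: Balaban1984PropagatorsI, (1.18) p.20] [folklore] -/
def avgS : Matrix (Anc N s × Fin d) (Tor N × Fin d) ℂ :=
  fun b i => if i.2 = b.2 then (s : ℂ)⁻¹ * ∑ t : Fin s, meanS N s b.1 (i.1 - tstep N b.2 t) else 0

/-- **(1.18) AT SCALE `s`**: `(Q_sA)(z,μ) = s^{−(d+1)}·Σ_j Σ_{t<s} A(z + j + t e_μ, μ)`. [cite: Balaban1984PropagatorsI, (1.18) p.20] [folklore] -/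
theorem avgS_mulVec (hs : ∀ ν, s ∣ N ν) (A : Tor N × Fin d → ℂ) (z : Anc N s) (μ : Fin d) :
    (avgS N s *ᵥ A) (z, μ)
      = ((s : ℂ) ^ (d + 1))⁻¹ * ∑ j : Fin d → Fin s, ∑ t : Fin s, A (site N s z.1 j + tstep N μ t, μ) := by
  have e1 : (avgS N s *ᵥ A) (z, μ) = ∑ y : Tor N, ((s : ℂ)⁻¹ * ∑ t : Fin s, meanS N s z (y - tstep N μ t)) * A (y, μ) := by
    simp only [Matrix.mulVec, dotProduct, avgS]
    rw [Fintype.sum_prod_type]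
    refine Finset.sum_congr rfl fun y _ => ?_
    simp only [ite_mul, zero_mul, Finset.sum_ite_eq', Finset.mem_univ, if_true]
  rw [e1]
  have e2 : ∀ t : Fin s, ∑ y : Tor N, meanS N s z (y - tstep N μ t) * A (y, μ)
      = ∑ x : Tor N, meanS N s z x * A (x + tstep N μ t, μ) := fun t =>
    (Fintype.sum_equiv (Equiv.addRight (tstep N μ t)) _ _ fun x => by simp).symm
  have e3 : ∀ t : Fin s, ∑ x : Tor N, meanS N s z x * A (x + tstep N μ t, μ)
      = ((s : ℂ) ^ d)⁻¹ * ∑ j : Fin d → Fin s, A (site N s z.1 j + tstep N μ t, μ) := by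
    intro t
    have := meanS_mulVec N s hs z (fun x => A (x + tstep N μ t, μ))
    simpa [Matrix.mulVec, dotProduct] using this
  calc ∑ y : Tor N, ((s : ℂ)⁻¹ * ∑ t : Fin s, meanS N s z (y - tstep N μ t)) * A (y, μ)
      = ∑ y : Tor N, ∑ t : Fin s, (s : ℂ)⁻¹ * (meanS N s z (y - tstep N μ t) * A (y, μ)) := by
        refine Finset.sum_congr rfl fun y _ => ?_
        rw [Finset.mul_sum, Finset.sum_mul]
        refine Finset.sum_congr rfl fun t _ => ?_
        ring
    _ = (s : ℂ)⁻¹ * ∑ t : Fin s, ∑ y : Tor N, meanS N s z (y - tstep N μ t) * A (y, μ) := by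
        rw [Finset.sum_comm, Finset.mul_sum]
        refine Finset.sum_congr rfl fun t _ => ?_
        rw [Finset.mul_sum]
    _ = (s : ℂ)⁻¹ * ∑ t : Fin s, (((s : ℂ) ^ d)⁻¹ * ∑ j : Fin d → Fin s, A (site N s z.1 j + tstep N μ t, μ)) := by
        simp_rw [e2, e3]
    _ = ((s : ℂ) ^ (d + 1))⁻¹ * ∑ j : Fin d → Fin s, ∑ t : Fin s, A (site N s z.1 j + tstep N μ t, μ) := by
        rw [← Finset.mul_sum, Finset.sum_comm, ← mul_assoc, pow_succ, mul_inv, mul_comm ((s : ℂ) ^ d)⁻¹]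

omit hN [NeZero s] in
/-- the contour telescopes: `Σ_{t<s} (λ(x + (t+1)e_μ) − λ(x + t e_μ)) = λ(x + s e_μ) − λ(x)`. [cite: Balaban1984PropagatorsI, (1.20) p.20 (shape)] [folklore] -/
theorem sum_contour_sub (lam : Tor N → ℂ) (x : Tor N) (μ : Fin d) :
    ∑ t : Fin s, (lam (x + tstep N μ t + unitVec N μ) - lam (x + tstep N μ t)) = lam (x + tstep N μ s) - lam x := by
  rw [Fin.sum_univ_eq_sum_range (fun t => lam (x + tstep N μ t + unitVec N μ) - lam (x + tstep N μ t)) s]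
  have h := Finset.sum_range_sub (fun t => lam (x + tstep N μ t)) s
  simp only [tstep_succ, ← add_assoc] at h
  rw [h, tstep_zero, add_zero]

/-- **BAŁABAN's INTERTWINER AT SCALE `s`** (`Q∂ = ∂₁Q′`, vector form): for every scalar `λ`,
`(Q_s(∂λ))(z,μ) = (c/s)·((Q′_sλ)(z + s e_μ) − (Q′_sλ)(z))` — the sub-block average of the gradient is the scale-`s` forward
difference of the sub-block means (`GradOp N c` carries the level factor `c`).
[cite: Balaban1984PropagatorsI, (1.55) p.27; Balaban1984PropagatorsI, (1.20) p.20] [folklore] -/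
theorem avgS_GradOp_mulVec (hs : ∀ ν, s ∣ N ν) (c : ℂ) (lam : Tor N → ℂ) (z : Anc N s) (μ : Fin d) :
    (avgS N s *ᵥ (GradOp N c *ᵥ lam)) (z, μ)
      = c * (s : ℂ)⁻¹ * ((meanS N s *ᵥ lam) (shiftAnc N s hs μ z) - (meanS N s *ᵥ lam) z) := by
  have hsc : (s : ℂ) ≠ 0 := by exact_mod_cast (NeZero.ne s)
  rw [avgS_mulVec N s hs, meanS_mulVec N s hs, meanS_mulVec N s hs]
  have e1 : ∀ j : Fin d → Fin s, ∑ t : Fin s, (GradOp N c *ᵥ lam) (site N s z.1 j + tstep N μ t, μ)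
      = c * (lam (site N s (shiftAnc N s hs μ z).1 j) - lam (site N s z.1 j)) := by
    intro j
    simp only [GradOp_mulVec, sdiff_mulVec]
    rw [← Finset.mul_sum, sum_contour_sub]
    congr 2
    show lam (site N s z.1 j + tstep N μ s) = lam (site N s (z.1 + tstep N μ s) j)
    rw [site_add]
  simp_rw [e1]
  rw [← Finset.mul_sum, Finset.sum_sub_distrib, pow_succ, mul_inv]
  ring

/-- the SCALE-`s` FORWARD GRADIENT ON ANCHORS (factor `c/s`): `(∂_sF)(z,μ) = (c/s)·(F(z + s e_μ) − F(z))` — the `Dg₁` of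
`RegionGaugeSlice.SliceData` for one layer. [cite: Balaban1984PropagatorsI, (1.20) p.20 (shape: ∂₁)] [folklore] -/
def gradS (hs : ∀ ν, s ∣ N ν) (c : ℂ) : Matrix (Anc N s × Fin d) (Anc N s) ℂ :=
  fun b w => c * (s : ℂ)⁻¹ * ((if w = shiftAnc N s hs b.2 b.1 then 1 else 0) - (if w = b.1 then 1 else 0))

omit [NeZero s] in
/-- `(∂_sF)(z,μ) = (c/s)·(F(z + s e_μ) − F(z))`. [folklore] -/
theorem gradS_mulVec (hs : ∀ ν, s ∣ N ν) (c : ℂ) (F : Anc N s → ℂ) (z : Anc N s) (μ : Fin d) :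
    (gradS N s hs c *ᵥ F) (z, μ) = c * (s : ℂ)⁻¹ * (F (shiftAnc N s hs μ z) - F z) := by
  simp only [Matrix.mulVec, dotProduct, gradS, mul_sub, sub_mul, Finset.sum_sub_distrib, mul_ite, mul_one, mul_zero,
    ite_mul, zero_mul, Finset.sum_ite_eq', Finset.mem_univ, if_true]

omit hN [NeZero s] in
/-- two matrices with the same action on every vector are equal. [folklore] -/
private theorem ext_of_mulVec {m n : Type*} [Fintype m] [Fintype n] [DecidableEq n] {A B : Matrix m n ℂ}
    (h : ∀ v, A *ᵥ v = B *ᵥ v) : A = B := by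
  funext i j
  have h1 := congrFun (h (Pi.single j 1)) i
  simpa [Matrix.mulVec, dotProduct, Pi.single_apply] using h1

/-- **`Q_s·∂ = ∂_s·Q′_s` AS MATRICES** — the `avg_grad` identity of `SliceData` for one scale-`s` layer of the graded well.
[cite: Balaban1984PropagatorsI, (1.55) p.27] [folklore] -/
theorem avgS_mul_GradOp (hs : ∀ ν, s ∣ N ν) (c : ℂ) :
    avgS N s * GradOp N c = gradS N s hs c * meanS N s := by
  refine ext_of_mulVec fun lam => ?_
  funext b
  obtain ⟨z, μ⟩ := b
  rw [← Matrix.mulVec_mulVec, ← Matrix.mulVec_mulVec, avgS_GradOp_mulVec N s hs, gradS_mulVec]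

end Summit.QuantumFields.BalabanUV.T4Continuum.GradedSubBlocks

end
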